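import Summits.CriticalPhenomena.PercolationContinuityZ3.Theorems.PercNearOneGluingNoHeavyLowerTailSahiCombTriWRectangle

/-!
# `TRI_W(a)` on every cell when one member is a STAIRCASE `⋁_i u_i(y) ∧ v_i(z)`: the exact band identity and the bandwise-Kleitman stratum

Support file of the one-cut programme (crux `NoHeavyLowerTail`, stmt-CriticalPhenomena-4575; lemma factory `prim-lf-1` gen 30; memo
`FROM-prim-lf-1-gen30-STAIRCASE.md`).  Companion of `…SahiCombTriWRectangle` (one member a rectangle `u(y) ∧ v(z)`, gen 29) and
`…SahiCombTriWPartialRefl` (one member a union of two cylinders `u(y) ∨ v(z)`).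

Setting (a CELL, as in `…SahiCombTriWRectangle`): `W = Finset γ` with a block `S ⊆ γ`, an index cube `Finset β`, a monotone family `F` of `S`-cylinders,
a monotone family `G` of `Sᶜ`-cylinders, and `P` a STAIRCASE: `P = stair A B K = ⋃_{i<K} A (i+1) ∩ B (i+1)` for a chain of `S`-cylinders
`∅ = A 0 ⊆ A 1 ⊆ A 2 ⊆ …` and an antitone chain of `Sᶜ`-cylinder up-sets `B 1 ⊇ B 2 ⊇ …` — in the three-cube dictionary `h(y,z) = ⋁_i [y ∈ u_i][z ∈ v_i]`,
i.e. `h` sees its two blocks through a pair of increasing LEVEL statistics (`h = [ℓ_u(y) ≤ ℓ_v(z)]`); `K = 1` is the rectangle, `u_K = Y, v_1 = Z` at `K = 2` is the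
union of two cylinders.  Every increasing function of two CHAIN statistics (e.g. of the two block sums) is such a staircase.

* `FiveUpSet.stair`, `FiveUpSet.stairPiece` — the staircase and its disjoint pieces `(A (i+1) \ A i) ∩ B (i+1)` (`stair_eq_biUnion_piece`,
  `stairPiece_pairwiseDisjoint`);
* `FiveUpSet.triWTerm_stair` — additivity: `triWTerm (stair A B K) F G x = Σ_{i<K} triWTerm (stairPiece A B i) F G x`;
* **`FiveUpSet.card_mul_triW_stair`** — the EXACT BAND IDENTITY: with the band profiles `p^i_x = #((A(i+1) \ A i) ∩ F x)`, `q^i_x = #((A(i+1) \ A i) ∩ refl (F x))`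
  of `F` and the up-set profiles `A^i_x = #(B (i+1) ∩ G x)`, `B^i_x = #(B (i+1) ∩ refl (G x))` of `G`,
  `#W · triW (stair A B K) F G = Σ_x Σ_{i<K} [ p^i_x (A^i_x − A^i_{xᶜ}) + (p^i_x − q^i_x)(A^i_{xᶜ} − B^i_{xᶜ}) + (p^i_x A^i_x − q^i_x B^i_x) ]`
  (the rectangle identity `card_mul_triWTerm_rectangle` piece by piece — it needs only cylinder-ness, not up-sets);
* **`FiveUpSet.triW_nonneg_of_stair_of_bandKleitman`** — `0 ≤ triW (stair A B K) F G` whenever the `F`-profiles satisfy Kleitman's inequality BANDWISE,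
  `#((A(i+1) \ A i) ∩ refl (F x)) ≤ #((A(i+1) \ A i) ∩ F x)` for all `i < K` and `x` (functional Kleitman `sum_card_mul_card_compl_le` + Kleitman inside the
  up-sets `B (i+1)`).  For `K = 1` (`A 1` an up-set) the hypothesis IS Kleitman's lemma, so this contains `triW_nonneg_of_rectangle`.
WHAT IS NOT PROVED.  For a general staircase of up-sets `A i` Kleitman's lemma gives the hypothesis only CUMULATIVELY (`Σ_{l≤i} q^l ≤ Σ_{l≤i} p^l`, from the
up-sets `A (i+1)`), not bandwise; the identity then reduces `0 ≤ triW (stair A B K) F G` to an inequality about `4K` monotone profile functions on the index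
cube alone (memo §2, "ASPI"; numerically true for `K ≤ 4`, `a ≤ 4`; no `x`-independent functional-Kleitman certificate exists for `K ≥ 2`, memo §3).
HONEST LABEL: an exact identity and the stratum it makes elementary; the staircase stratum of `FiveUpSet.TriWIneq` in general remains OPEN. [this work]
-/

namespace Summit.CriticalPhenomena.PercolationContinuityZ3.Theorems

namespace FiveUpSet

open Finset

variable {β γ : Type} [DecidableEq β] [Fintype β] [DecidableEq γ] [Fintype γ]

/-! ### Cylinders: set difference -/

omit [Fintype γ] in
/-- The difference of two `T`-cylinders is a `T`-cylinder. [this work] -/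
theorem sdiff_cyl {T : Finset γ} {A C : Finset (Finset γ)} (hA : ∀ e e', e ∩ T = e' ∩ T → (e ∈ A ↔ e' ∈ A))
    (hC : ∀ e e', e ∩ T = e' ∩ T → (e ∈ C ↔ e' ∈ C)) :
    ∀ e e' : Finset γ, e ∩ T = e' ∩ T → (e ∈ A \ C ↔ e' ∈ A \ C) := by
  intro e e' h
  rw [mem_sdiff, mem_sdiff, hA e e' h, hC e e' h]

/-! ### Staircases and their disjoint pieces -/

omit [Fintype γ] in
/-- The `K`-step STAIRCASE over two chains of families: `stair A B K = ⋃_{i<K} A (i+1) ∩ B (i+1)`.  In the cell dictionary (`A i = u_i × Z`,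
`B i = Y × v_i`, `u_1 ⊆ u_2 ⊆ …`, `v_1 ⊇ v_2 ⊇ …`) this is `h(y,z) = ⋁_{i ≤ K} [y ∈ u_i ∧ z ∈ v_i]`. [this work] -/
def stair (A B : ℕ → Finset (Finset γ)) (K : ℕ) : Finset (Finset γ) :=
  (range K).biUnion fun i => A (i + 1) ∩ B (i + 1)

omit [Fintype γ] in
/-- The `i`-th piece of a staircase: the band `A (i+1) \ A i` of the first chain met with `B (i+1)`. [this work] -/
def stairPiece (A B : ℕ → Finset (Finset γ)) (i : ℕ) : Finset (Finset γ) :=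
  (A (i + 1) \ A i) ∩ B (i + 1)

omit [Fintype γ] in
/-- The pieces of a staircase over a monotone first chain are pairwise disjoint. [this work] -/
theorem stairPiece_pairwiseDisjoint (A B : ℕ → Finset (Finset γ)) (hAm : Monotone A) (s : Set ℕ) :
    s.PairwiseDisjoint (stairPiece A B) := by
  intro i _ j _ hij
  rw [Function.onFun, disjoint_left]
  intro e hei hej
  simp only [stairPiece, mem_inter, mem_sdiff] at hei hej
  rcases lt_or_gt_of_ne hij with h | h
  · exact hej.1.2 (hAm (Nat.succ_le_of_lt h) hei.1.1)
  · exact hei.1.2 (hAm (Nat.succ_le_of_lt h) hej.1.1)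

omit [Fintype γ] in
/-- **Disjoint decomposition of a staircase.**  If `A 0 = ∅` and `B` is antitone, then
`stair A B K = ⋃_{i<K} (A (i+1) \ A i) ∩ B (i+1)` (a point of the staircase lies in the piece of the FIRST level of `A` containing it). [this work] -/
theorem stair_eq_biUnion_piece (A B : ℕ → Finset (Finset γ)) (K : ℕ) (hA0 : A 0 = ∅) (hBa : Antitone B) :
    stair A B K = (range K).biUnion (stairPiece A B) := by
  ext e
  simp only [stair, stairPiece, mem_biUnion, mem_range, mem_inter, mem_sdiff]
  constructor
  · rintro ⟨i, hi, heA, heB⟩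
    have hex : ∃ n, e ∈ A (n + 1) := ⟨i, heA⟩
    have hmA : e ∈ A (Nat.find hex + 1) := Nat.find_spec hex
    have hmi : Nat.find hex ≤ i := Nat.find_min' hex heA
    refine ⟨Nat.find hex, lt_of_le_of_lt hmi hi, ⟨hmA, ?_⟩, hBa (Nat.succ_le_succ hmi) heB⟩
    intro hmem
    by_cases h0 : Nat.find hex = 0
    · rw [h0, hA0] at hmem
      simp at hmem
    · obtain ⟨m', hm'⟩ := Nat.exists_eq_succ_of_ne_zero h0
      have hlt : m' < Nat.find hex := by rw [hm']; exact Nat.lt_succ_self m'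
      have hnot := Nat.find_min hex hlt
      rw [hm'] at hmem
      exact hnot hmem
  · rintro ⟨i, hi, ⟨heA, -⟩, heB⟩
    exact ⟨i, hi, heA, heB⟩

omit [Fintype γ] in
/-- Additivity of cardinalities over the pieces: `#(stair A B K ∩ T) = Σ_{i<K} #(stairPiece A B i ∩ T)`. [this work] -/
theorem card_stair_inter (A B : ℕ → Finset (Finset γ)) (K : ℕ) (hA0 : A 0 = ∅) (hAm : Monotone A) (hBa : Antitone B)
    (T : Finset (Finset γ)) :
    ((stair A B K ∩ T).card : ℤ) = ∑ i ∈ range K, ((stairPiece A B i ∩ T).card : ℤ) := by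
  rw [stair_eq_biUnion_piece A B K hA0 hBa, biUnion_inter, card_biUnion]
  · push_cast
    rfl
  · exact (stairPiece_pairwiseDisjoint A B hAm _).mono fun i => inter_subset_left

/-- **Additivity of `triWTerm` over the pieces of a staircase.** [this work] -/
theorem triWTerm_stair (A B : ℕ → Finset (Finset γ)) (K : ℕ) (hA0 : A 0 = ∅) (hAm : Monotone A) (hBa : Antitone B)
    (F G : Finset β → Finset (Finset γ)) (x : Finset β) :
    triWTerm (stair A B K) F G x = ∑ i ∈ range K, triWTerm (stairPiece A B i) F G x := by
  have h := fun T => card_stair_inter A B K hA0 hAm hBa T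
  unfold triWTerm
  simp only [inter_assoc]
  rw [h, h, h, h, h]
  rw [Finset.mul_sum, ← Finset.sum_sub_distrib, ← Finset.sum_sub_distrib, ← Finset.sum_sub_distrib, ← Finset.sum_add_distrib]

/-! ### The exact band identity -/

/-- **`#W · triW` on a staircase: the band identity.**  With `p = #((A(i+1) \ A i) ∩ F x)`, `q = #((A(i+1) \ A i) ∩ refl (F x))`, `A' y = #(B(i+1) ∩ G y)`,
`B' y = #(B(i+1) ∩ refl (G y))`:  `#W · triW (stair A B K) F G = Σ_x Σ_{i<K} [p (A' x − A' xᶜ) + (p − q)(A' xᶜ − B' xᶜ) + (p A' x − q B' x)]`. [this work] -/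
theorem card_mul_triW_stair (S : Finset γ) (A B : ℕ → Finset (Finset γ)) (K : ℕ) (F G : Finset β → Finset (Finset γ))
    (hA0 : A 0 = ∅) (hAm : Monotone A) (hBa : Antitone B)
    (hA : ∀ i e e', e ∩ S = e' ∩ S → (e ∈ A i ↔ e' ∈ A i)) (hB : ∀ i e e', e ∩ Sᶜ = e' ∩ Sᶜ → (e ∈ B i ↔ e' ∈ B i))
    (hFc : ∀ x e e', e ∩ S = e' ∩ S → (e ∈ F x ↔ e' ∈ F x)) (hGc : ∀ x e e', e ∩ Sᶜ = e' ∩ Sᶜ → (e ∈ G x ↔ e' ∈ G x)) :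
    (Fintype.card (Finset γ) : ℤ) * triW (stair A B K) F G
      = ∑ x : Finset β, ∑ i ∈ range K,
          ((((A (i + 1) \ A i) ∩ F x).card : ℤ) * ((((B (i + 1)) ∩ G x).card : ℤ) - ((B (i + 1)) ∩ G xᶜ).card)
            + ((((A (i + 1) \ A i) ∩ F x).card : ℤ) - ((A (i + 1) \ A i) ∩ refl (F x)).card)
                * ((((B (i + 1)) ∩ G xᶜ).card : ℤ) - ((B (i + 1)) ∩ refl (G xᶜ)).card)
            + ((((A (i + 1) \ A i) ∩ F x).card : ℤ) * ((B (i + 1)) ∩ G x).card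
                - (((A (i + 1) \ A i) ∩ refl (F x)).card : ℤ) * ((B (i + 1)) ∩ refl (G x)).card)) := by
  unfold triW
  rw [Finset.mul_sum]
  refine Finset.sum_congr rfl fun x _ => ?_
  rw [triWTerm_stair A B K hA0 hAm hBa F G x, Finset.mul_sum]
  refine Finset.sum_congr rfl fun i _ => ?_
  exact card_mul_triWTerm_rectangle S (A (i + 1) \ A i) (B (i + 1)) F G (sdiff_cyl (hA (i + 1)) (hA i)) (hB (i + 1)) hFc hGc x

/-! ### The bandwise-Kleitman stratum -/

/-- **`TRI_W(a) ≥ 0` on a staircase whose first-block bands satisfy Kleitman's inequality bandwise.**  Let `S ⊆ γ` be a block, `F` a monotone family of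
`S`-cylinders, `G` a monotone family of `Sᶜ`-cylinder up-sets (any index cube), `∅ = A 0 ⊆ A 1 ⊆ …` a chain of `S`-cylinders and `B 1 ⊇ B 2 ⊇ …` an antitone
chain of `Sᶜ`-cylinder up-sets.  If `#((A(i+1) \ A i) ∩ refl (F x)) ≤ #((A(i+1) \ A i) ∩ F x)` for all `i < K` and all `x` (Kleitman's inequality for `F x`
inside each BAND of the first chain), then `0 ≤ triW (stair A B K) F G`.  Each summand of `card_mul_triW_stair` is then `≥ 0` exactly as in
`triW_nonneg_of_rectangle`: functional Kleitman for the first, the hypothesis and Kleitman inside the up-set `B (i+1)` for the other two.  At `K = 1` with `A 1`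
an up-set the hypothesis is Kleitman's lemma (`card_inter_refl_le`), so this contains the rectangle stratum; for general up-sets `A i` Kleitman's lemma
only gives the CUMULATIVE sums `Σ_{l≤i}` of the hypothesis (memo §2). [this work] -/
theorem triW_nonneg_of_stair_of_bandKleitman (S : Finset γ) (A B : ℕ → Finset (Finset γ)) (K : ℕ) (F G : Finset β → Finset (Finset γ))
    (hA0 : A 0 = ∅) (hAm : Monotone A) (hBa : Antitone B)
    (hA : ∀ i e e', e ∩ S = e' ∩ S → (e ∈ A i ↔ e' ∈ A i)) (hB : ∀ i e e', e ∩ Sᶜ = e' ∩ Sᶜ → (e ∈ B i ↔ e' ∈ B i))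
    (hBu : ∀ i, IsUpperSet (B i : Set (Finset γ)))
    (hFc : ∀ x e e', e ∩ S = e' ∩ S → (e ∈ F x ↔ e' ∈ F x)) (hGc : ∀ x e e', e ∩ Sᶜ = e' ∩ Sᶜ → (e ∈ G x ↔ e' ∈ G x))
    (hG : ∀ x, IsUpperSet (G x : Set (Finset γ))) (hFm : Monotone F) (hGm : Monotone G)
    (hband : ∀ i, i < K → ∀ x : Finset β, (((A (i + 1) \ A i) ∩ refl (F x)).card : ℤ) ≤ ((A (i + 1) \ A i) ∩ F x).card) :
    0 ≤ triW (stair A B K) F G := by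
  have hN : (0 : ℤ) < (Fintype.card (Finset γ) : ℤ) := by exact_mod_cast Fintype.card_pos
  have key := card_mul_triW_stair S A B K F G hA0 hAm hBa hA hB hFc hGc
  have hab' : ∀ i (y : Finset β), (((B (i + 1)) ∩ refl (G y)).card : ℤ) ≤ ((B (i + 1)) ∩ G y).card := fun i y => by
    exact_mod_cast card_inter_refl_le (hBu (i + 1)) (hG y)
  have htot : 0 ≤ (Fintype.card (Finset γ) : ℤ) * triW (stair A B K) F G := by
    rw [key, Finset.sum_comm]
    refine Finset.sum_nonneg fun i hi => ?_
    rw [mem_range] at hi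
    rw [Finset.sum_add_distrib, Finset.sum_add_distrib]
    refine add_nonneg (add_nonneg ?_ ?_) ?_
    · have h := sum_card_mul_card_compl_le (A (i + 1) \ A i) (B (i + 1)) hFm hGm
      have e : ∑ x : Finset β, (((A (i + 1) \ A i) ∩ F x).card : ℤ) * ((((B (i + 1)) ∩ G x).card : ℤ) - ((B (i + 1)) ∩ G xᶜ).card)
          = ∑ x : Finset β, (((A (i + 1) \ A i) ∩ F x).card : ℤ) * (((B (i + 1)) ∩ G x).card : ℤ)
            - ∑ x : Finset β, (((A (i + 1) \ A i) ∩ F x).card : ℤ) * (((B (i + 1)) ∩ G xᶜ).card : ℤ) := by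
        rw [← Finset.sum_sub_distrib]
        exact Finset.sum_congr rfl fun x _ => by ring
      rw [e]; linarith
    · exact Finset.sum_nonneg fun x _ => mul_nonneg (sub_nonneg.2 (hband i hi x)) (sub_nonneg.2 (hab' i xᶜ))
    · refine Finset.sum_nonneg fun x _ => sub_nonneg.2 ?_
      exact mul_le_mul (hband i hi x) (hab' i x) (by positivity) (by positivity)
  exact le_of_mul_le_mul_left (by rw [mul_zero]; exact htot) hN

/-! ### The abstract staircase profile inequality and the reduction -/

/-- **The STAIRCASE PROFILE INEQUALITY `ASPI(K)`** (CONJECTURE — an obligation isolated by `card_mul_triW_stair`, never a fact; memo §2).  On an index cube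
`Finset β` (antipode `x ↦ xᶜ`) let `p i, q i ≥ 0` be monotone "band profiles" whose partial sums satisfy Kleitman's inequality CUMULATIVELY
(`Σ_{l≤i} q l x ≤ Σ_{l≤i} p l x`), and let `A i ≥ B i ≥ 0` be monotone "up-set profiles", antitone in the level `i`, whose level bands
`A i − A (i+1)`, `B i − B (i+1)` are monotone in `x`.  Then `0 ≤ Σ_x Σ_{i<K} [2 p A − q A(xᶜ) − p B(xᶜ) − q B + q B(xᶜ)]`.
`K = 1` is the profile form of the rectangle stratum (true: `triW_nonneg_of_stair_of_bandKleitman`); numerically true (alternating-LP falsification and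
random search, memo §2) for `K ≤ 4` on cubes of dimension `≤ 4`; NO certificate by `x`-independent functional-Kleitman multipliers exists for `K ≥ 2` (memo §3).
By `triW_nonneg_of_stair_of_profileIneq` it implies `0 ≤ triW` for every `K`-step staircase on every cell. OPEN for `K ≥ 2`. [this work] -/
@[conjecture] def StairProfileIneq (K : ℕ) : Prop :=
  ∀ (β : Type) [DecidableEq β] [Fintype β] (p q A B : ℕ → Finset β → ℤ),
    (∀ i, Monotone (p i)) → (∀ i, Monotone (q i)) → (∀ i x, 0 ≤ p i x) → (∀ i x, 0 ≤ q i x) →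
    (∀ i x, (∑ l ∈ Finset.range (i + 1), q l x) ≤ ∑ l ∈ Finset.range (i + 1), p l x) →
    (∀ i, Monotone (A i)) → (∀ i, Monotone (B i)) → (∀ i x, 0 ≤ B i x) → (∀ i x, B i x ≤ A i x) →
    (∀ i x, A (i + 1) x ≤ A i x) → (∀ i x, B (i + 1) x ≤ B i x) →
    (∀ i, Monotone (fun x => A i x - A (i + 1) x)) → (∀ i, Monotone (fun x => B i x - B (i + 1) x)) →
    0 ≤ ∑ x : Finset β, ∑ i ∈ Finset.range K,
      (2 * p i x * A i x - q i x * A i xᶜ - p i x * B i xᶜ - q i x * B i x + q i x * B i xᶜ)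

/-- `refl` is monotone for inclusion (local copy of `…TriWGenU.refl_subset_refl`). [this work] -/
private theorem refl_subset_refl' {𝒜 ℬ : Finset (Finset γ)} (h : 𝒜 ⊆ ℬ) : refl 𝒜 ⊆ refl ℬ := by
  intro s hs
  rw [mem_refl] at hs ⊢
  exact h hs

omit [Fintype γ] in
/-- Telescoping of the bands of a chain: `Σ_{l<i} #((A (l+1) \ A l) ∩ T) = #(A i ∩ T)` when `A 0 = ∅` and `A` is monotone. [this work] -/
theorem sum_card_band_inter (A : ℕ → Finset (Finset γ)) (hA0 : A 0 = ∅) (hAm : Monotone A) (T : Finset (Finset γ)) (i : ℕ) :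
    ∑ l ∈ range i, (((A (l + 1) \ A l) ∩ T).card : ℤ) = ((A i ∩ T).card : ℤ) := by
  induction i with
  | zero => simp [hA0]
  | succ n ih =>
    rw [sum_range_succ, ih]
    have hdisj : Disjoint (A n ∩ T) ((A (n + 1) \ A n) ∩ T) := by
      rw [disjoint_left]
      intro e he he'
      rw [mem_inter] at he
      rw [mem_inter, mem_sdiff] at he'
      exact he'.1.2 he.1
    have hun : A (n + 1) ∩ T = (A n ∩ T) ∪ ((A (n + 1) \ A n) ∩ T) := by
      ext e
      simp only [mem_inter, mem_union, mem_sdiff]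
      constructor
      · intro h
        by_cases hn : e ∈ A n
        · exact Or.inl ⟨hn, h.2⟩
        · exact Or.inr ⟨⟨h.1, hn⟩, h.2⟩
      · rintro (h | h)
        · exact ⟨hAm (Nat.le_succ n) h.1, h.2⟩
        · exact ⟨h.1.1, h.2⟩
    rw [hun, card_union_of_disjoint hdisj]
    push_cast
    ring

omit [Fintype γ] in
/-- Band counts of a chain met with a monotone family, as a difference: `#(B i ∩ G x) − #(B (i+1) ∩ G x) = #((B i \ B (i+1)) ∩ G x)` for antitone `B`. [this work] -/
theorem card_inter_sub_card_inter_eq {B : ℕ → Finset (Finset γ)} (hBa : Antitone B) (X : Finset (Finset γ)) (i : ℕ) :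
    ((B i ∩ X).card : ℤ) - ((B (i + 1) ∩ X).card : ℤ) = (((B i \ B (i + 1)) ∩ X).card : ℤ) := by
  have hsub : B (i + 1) ∩ X ⊆ B i ∩ X := inter_subset_inter_right (hBa (Nat.le_succ i))
  have hset : (B i \ B (i + 1)) ∩ X = (B i ∩ X) \ (B (i + 1) ∩ X) := by
    ext e; simp only [mem_inter, mem_sdiff]; tauto
  rw [hset, card_sdiff_of_subset hsub, Nat.cast_sub (card_le_card hsub)]

/-- **REDUCTION: the staircase profile inequality implies `TRI_W(a) ≥ 0` on every `K`-step staircase of every cell.**  For a block `S`, monotone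
cylinder families of up-sets `F` (`S`-cylinders) and `G` (`Sᶜ`-cylinders) over any index cube, a monotone chain of `S`-cylinder UP-SETS `∅ = A 0 ⊆ A 1 ⊆ …`
and an antitone chain of `Sᶜ`-cylinder up-sets `B`, `StairProfileIneq K` gives `0 ≤ triW (stair A B K) F G`: the band/up-set profiles of the actual
families satisfy every hypothesis of `StairProfileIneq` (monotonicity from `F, G` monotone; `q`'s cumulative sums are `#(A (i+1) ∩ refl (F x)) ≤
#(A (i+1) ∩ F x)` by `sum_card_band_inter` and Kleitman's lemma in the up-set `A (i+1)`; `B ≤ A` by Kleitman in `B (i+1)`), and `card_mul_triW_stair`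
is, summand by summand, the sum bounded by `StairProfileIneq`. [this work] -/
theorem triW_nonneg_of_stair_of_profileIneq {K : ℕ} (hSPI : StairProfileIneq K) (S : Finset γ) (A B : ℕ → Finset (Finset γ))
    (F G : Finset β → Finset (Finset γ))
    (hA0 : A 0 = ∅) (hAm : Monotone A) (hBa : Antitone B)
    (hA : ∀ i e e', e ∩ S = e' ∩ S → (e ∈ A i ↔ e' ∈ A i)) (hB : ∀ i e e', e ∩ Sᶜ = e' ∩ Sᶜ → (e ∈ B i ↔ e' ∈ B i))
    (hAu : ∀ i, IsUpperSet (A i : Set (Finset γ))) (hBu : ∀ i, IsUpperSet (B i : Set (Finset γ)))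
    (hFc : ∀ x e e', e ∩ S = e' ∩ S → (e ∈ F x ↔ e' ∈ F x)) (hGc : ∀ x e e', e ∩ Sᶜ = e' ∩ Sᶜ → (e ∈ G x ↔ e' ∈ G x))
    (hF : ∀ x, IsUpperSet (F x : Set (Finset γ))) (hG : ∀ x, IsUpperSet (G x : Set (Finset γ))) (hFm : Monotone F) (hGm : Monotone G) :
    0 ≤ triW (stair A B K) F G := by
  have hN : (0 : ℤ) < (Fintype.card (Finset γ) : ℤ) := by exact_mod_cast Fintype.card_pos
  -- monotonicity of profiles of monotone families
  have mono_card : ∀ (T : Finset (Finset γ)) (H : Finset β → Finset (Finset γ)), Monotone H →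
      ∀ x y : Finset β, x ≤ y → ((T ∩ H x).card : ℤ) ≤ ((T ∩ H y).card : ℤ) := by
    intro T H hH x y hxy
    exact_mod_cast card_le_card (inter_subset_inter_left (hH hxy))
  have hreflF : Monotone (fun x => refl (F x)) := fun x y hxy => refl_subset_refl' (hFm hxy)
  have hreflG : Monotone (fun x => refl (G x)) := fun x y hxy => refl_subset_refl' (hGm hxy)
  have hBa' : Antitone (fun i => B (i + 1)) := fun i j hij => hBa (Nat.succ_le_succ hij)
  -- the thirteen hypotheses of `StairProfileIneq` for the actual band / up-set profiles
  have h1 : ∀ i, Monotone (fun x => (((A (i + 1) \ A i) ∩ F x).card : ℤ)) :=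
    fun i x y hxy => mono_card _ F hFm x y hxy
  have h2 : ∀ i, Monotone (fun x => (((A (i + 1) \ A i) ∩ refl (F x)).card : ℤ)) :=
    fun i x y hxy => mono_card _ (fun x => refl (F x)) hreflF x y hxy
  have h3 : ∀ (i : ℕ) (x : Finset β), (0 : ℤ) ≤ (((A (i + 1) \ A i) ∩ F x).card : ℤ) := fun i x => by positivity
  have h4 : ∀ (i : ℕ) (x : Finset β), (0 : ℤ) ≤ (((A (i + 1) \ A i) ∩ refl (F x)).card : ℤ) := fun i x => by positivity
  have h5 : ∀ (i : ℕ) (x : Finset β), (∑ l ∈ range (i + 1), (((A (l + 1) \ A l) ∩ refl (F x)).card : ℤ))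
      ≤ ∑ l ∈ range (i + 1), (((A (l + 1) \ A l) ∩ F x).card : ℤ) := by
    intro i x
    rw [sum_card_band_inter A hA0 hAm (refl (F x)) (i + 1), sum_card_band_inter A hA0 hAm (F x) (i + 1)]
    exact_mod_cast card_inter_refl_le (hAu (i + 1)) (hF x)
  have h6 : ∀ i, Monotone (fun x => ((B (i + 1) ∩ G x).card : ℤ)) := fun i x y hxy => mono_card _ G hGm x y hxy
  have h7 : ∀ i, Monotone (fun x => ((B (i + 1) ∩ refl (G x)).card : ℤ)) :=
    fun i x y hxy => mono_card _ (fun x => refl (G x)) hreflG x y hxy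
  have h8 : ∀ (i : ℕ) (x : Finset β), (0 : ℤ) ≤ ((B (i + 1) ∩ refl (G x)).card : ℤ) := fun i x => by positivity
  have h9 : ∀ (i : ℕ) (x : Finset β), ((B (i + 1) ∩ refl (G x)).card : ℤ) ≤ ((B (i + 1) ∩ G x).card : ℤ) := fun i x => by
    exact_mod_cast card_inter_refl_le (hBu (i + 1)) (hG x)
  have h10 : ∀ (i : ℕ) (x : Finset β), ((B (i + 1 + 1) ∩ G x).card : ℤ) ≤ ((B (i + 1) ∩ G x).card : ℤ) := fun i x => by
    exact_mod_cast card_le_card (inter_subset_inter_right (hBa (Nat.le_succ (i + 1))))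
  have h11 : ∀ (i : ℕ) (x : Finset β), ((B (i + 1 + 1) ∩ refl (G x)).card : ℤ) ≤ ((B (i + 1) ∩ refl (G x)).card : ℤ) :=
    fun i x => by
    exact_mod_cast card_le_card (inter_subset_inter_right (hBa (Nat.le_succ (i + 1))))
  have h12 : ∀ i, Monotone (fun x => ((B (i + 1) ∩ G x).card : ℤ) - ((B (i + 1 + 1) ∩ G x).card : ℤ)) := by
    intro i x y hxy
    show ((B (i + 1) ∩ G x).card : ℤ) - ((B (i + 1 + 1) ∩ G x).card : ℤ)
        ≤ ((B (i + 1) ∩ G y).card : ℤ) - ((B (i + 1 + 1) ∩ G y).card : ℤ)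
    rw [card_inter_sub_card_inter_eq hBa' (G x) i, card_inter_sub_card_inter_eq hBa' (G y) i]
    exact mono_card _ G hGm x y hxy
  have h13 : ∀ i, Monotone (fun x => ((B (i + 1) ∩ refl (G x)).card : ℤ) - ((B (i + 1 + 1) ∩ refl (G x)).card : ℤ)) := by
    intro i x y hxy
    show ((B (i + 1) ∩ refl (G x)).card : ℤ) - ((B (i + 1 + 1) ∩ refl (G x)).card : ℤ)
        ≤ ((B (i + 1) ∩ refl (G y)).card : ℤ) - ((B (i + 1 + 1) ∩ refl (G y)).card : ℤ)
    rw [card_inter_sub_card_inter_eq hBa' (refl (G x)) i, card_inter_sub_card_inter_eq hBa' (refl (G y)) i]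
    exact mono_card _ (fun x => refl (G x)) hreflG x y hxy
  have hineq := hSPI β (fun i x => (((A (i + 1) \ A i) ∩ F x).card : ℤ)) (fun i x => (((A (i + 1) \ A i) ∩ refl (F x)).card : ℤ))
    (fun i x => ((B (i + 1) ∩ G x).card : ℤ)) (fun i x => ((B (i + 1) ∩ refl (G x)).card : ℤ))
    h1 h2 h3 h4 h5 h6 h7 h8 h9 h10 h11 h12 h13
  have key := card_mul_triW_stair S A B K F G hA0 hAm hBa hA hB hFc hGc
  have htot : 0 ≤ (Fintype.card (Finset γ) : ℤ) * triW (stair A B K) F G := by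
    rw [key]
    refine le_trans hineq (le_of_eq ?_)
    refine Finset.sum_congr rfl fun x _ => Finset.sum_congr rfl fun i _ => ?_
    ring
  exact le_of_mul_le_mul_left (by rw [mul_zero]; exact htot) hN

end FiveUpSet

end Summit.CriticalPhenomena.PercolationContinuityZ3.Theorems
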